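import Summits.QuantumFields.YangMills.Theorems.UnitScaleTiltProp7SigmaRepOfThm2S
import Summits.QuantumFields.YangMills.Theorems.UnitScaleTiltProp7SPrintDefs
import HarnessLib

/-!
# Route `UnitScaleTilt`, crux K1 «MinimiserStabilityRegPr» (stmt-QuantumFields-19200) — THE GROWTH ROW `hcoW` OF THE EX KNIT FROM ITS Σ-TWIN `hcoΣ` AND THE KNIT’S OWN THEOREM-2 SOCKET:
# `hcoW` ⇐ `hThm2S` ∧ `hcoΣ`, where `hcoΣ` = [Balaban1985Variational] (141)–(142) stated for Σ-REPRESENTATIVES `X` — (19) `In19`, (20) `AvgCondPrint`, (21) `IsLandauPrint` — with NO gauge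
# transformation in the binder (namer LOCATE v3 «GAUGE HOLE», 2026-08-29)

Cell `ym3-torus` ∕ fleet seat `ym-ust-19200-p1` (gen 17, route-R E′ lead ∕ namer).  THEOREMS ONLY (0 `def`, 0 `sorry`); `--supports stmt-QuantumFields-19200`, count-neutral.
YM₃ on T³ is a ladder rung (R3), not the Clay problem; nothing here claims the stub, the crux, `hcoW`, `hcoΣ`, d = 4 or the mass gap — `hcoΣ` is DISPLAYED.

WHY (namer LOCATE v3).  The socket `hcoW` of the EX knit (✓`Prop7StubEXOfChartPiecesTwS5.stubEX_of_chartPiecesTwS5`) quantifies over Theorem-2 data `(u, A)` of a competitor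
`(e^{iηA}W)^u ∈ (6)(e) ∩ 𝔅_k(V)` with (1.29) `RestrictedPrint W u` but WITHOUT the axial clause `IsAxialPrint W ((e^{iηA}W)^u)` that ties `u`’s centre values to the twisted frames
of `ηA` ([Balaban1985Averaging] (84)–(87) p.31).  Its binder therefore admits GAUGE-HEAVY data: `ηA` a pure residual-Landau gauge mode `−D_Wω` (`R(W)Δ_Wω = 0`, `Q′ω ≠ 0`) with `u`
adjusted off the centres — for which every growth row booked in the chart mass `M = Σ‖ηA‖²` (HESS `κ·M ≤ K` of ✓`hcoW_of_gaugedRowsW`, QSMALL of ✓`hcoW_of_sigmaRowsW[…]`) is false while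
`hcoW`’s conclusion holds trivially by gauge invariance.  Print never meets such data: its competitor coordinates are the Σ-representatives ((19)–(21) p.281 with `B = 0`, p.299 «B = 0,
hence the configurations A′ satisfy the same conditions as δA′»), on which the coarse gauge is the explicit frame functional and the averaging penalty is second order.  This file moves
the growth side to those letters at NO cost to the EX knit: every competitor `W′ ∈ (6)(e) ∩ 𝔅_k(V)` has a Σ-representative with the same action (px13 ✓`Prop7SigmaRepOfThm2S.
exists_sigmaRep_of_thm2S`, fed by the knit’s OWN socket `hThm2S` VERBATIM), so `hcoW` follows from its Σ-twin `hcoΣ` by `A((e^{iηA}W)^u) = A(e^{iηA}W)` (✓`wilsonAction_gaugeAct`).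

WHAT IS PROVED (ns `…Theorems.Prop7HcoWOfHcoSigma`): ★★★ `hcoW_of_hcoSigma (hThm2S) (hcoΣ) : hcoW` — `hThm2S` = the EX knit’s Theorem-2 socket VERBATIM; `hcoΣ` = «for `W ∈ (6)(e) ∩ 𝔅_k(V)`
E–L-critical along fibre curves and every `X` with `In19 F n K (2B₁′e) W (e^{iX}) X`, `AvgCondPrint V W X`, `IsLandauPrint W X`: `A(W) ≤ A(e^{iX}W)`» (`∀ B₁′ > 0 ∃ e₇ > 0`, L-only);
CONCLUSION = `hcoW` VERBATIM (S18ᴸ ✓p688219).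
HONEST SCOPE.  Re-representation bookkeeping over landed theorems; `hcoΣ` ((141)–(142) on Σ) is DISPLAYED and is the growth side’s new socket; nothing of print is asserted.

References: T. Bałaban, CMP 102 (1985) 277–309 [Balaban1985Variational] (Prop. 2, (18)–(21) pp.280–281, (141)–(143) p.299, Prop. 7 p.299); CMP 99 (1985) 75–102
[Balaban1985RegularSpaces] (Thm 2 p.83, (1.29) p.81, (1.36)–(1.38) p.82); CMP 98 (1985) 17–51 [Balaban1985Averaging] ((84)–(88), (92) p.31, Prop. 2 p.26).
-/

set_option autoImplicit false
noncomputable section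

open scoped BigOperators Matrix.Norms.L2Operator Matrix Topology
open Filter NormedSpace

namespace Summit.QuantumFields.YangMills.Theorems.Prop7HcoWOfHcoSigma

open Literature.MathematicalPhysics.QuantumFieldTheory.Balaban1983to89
open Literature.MathematicalPhysics.QuantumFieldTheory.Balaban1983to89.T3ContinuumYM3Torus
open Literature.MathematicalPhysics.QuantumFieldTheory.Balaban1983to89.T3UnitLawDensityEML (ℰp)
open Literature.MathematicalPhysics.QuantumFieldTheory.Balaban1983to89.T3ConstrainedMinimiser (fibre)
open Literature.MathematicalPhysics.QuantumFieldTheory.Balaban1983to89.T3PrintedRegularMinimiser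
open Literature.MathematicalPhysics.QuantumFieldTheory.Balaban1983to89.T3RegularMinimiser
open Literature.MathematicalPhysics.QuantumFieldTheory.Balaban1983to89.T3Thm1Carrier
open T4Continuum BlockAveraging AveragingRT ExpMeanLog
open B10Eq27TorusAxialLog (pull)
open T3SectALandauChart (emb15 eta bgUnits In19)
open B7Prop1Explicit renaming Site → LSite
open B7Prop2Explicit (C0 c2' C0_pos c2'_pos)
open B8Thm2SetupTorus (Thm2SetupSUAt)
open Summit.QuantumFields.YangMills.Theorems.Prop7TPrint (expHermField)
open Summit.QuantumFields.YangMills.Theorems.Prop7SPrint (basePt RestrictedPrint AvgCondPrint IsLandauPrint)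
open Summit.QuantumFields.YangMills.Theorems.Prop7SigmaRepOfThm2S (exists_sigmaRep_of_thm2S)

set_option maxHeartbeats 400000 in
/-- ★★★ **`hcoW` ⇐ THE EX KNIT’S THEOREM-2 SOCKET ∧ `hcoΣ`** ((141)–(142) on Σ-representatives).  Given `hThm2S` (VERBATIM the socket of ✓`stubEX_of_chartPiecesTwS5`) and
`hcoΣ : ∀ L > 1, ∀ B₁′ > 0, ∃ e₇ > 0, ∀ F (F.L = L) n < K, e ∈ (0, e₇], V, W ∈ (6)(e) ∩ 𝔅_k(V)` E–L-critical along fibre curves, `∀ X`, `In19 F n K (2B₁′e) W (e^{iX}) X →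
AvgCondPrint V W X → IsLandauPrint W X → A(W) ≤ A(e^{iX}W)`, the socket `hcoW` holds VERBATIM: the competitor `(e^{iηA}W)^u ∈ (6)(e) ∩ 𝔅_k(V)` of the binder has a
Σ-representative `(u″, X″)` with the same action (✓`exists_sigmaRep_of_thm2S`), `hcoΣ` bounds `A(W)` by it, and `A((e^{iηA}W)^u) = A(e^{iηA}W)` (✓`wilsonAction_gaugeAct`).
[cite: Balaban1985Variational, Prop. 2 p.281, (18)-(21) pp.280-281, (141)-(142) p.299; Balaban1985RegularSpaces, Thm 2 p.83; Balaban1985Averaging, (84)-(88) p.31] -/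
theorem hcoW_of_hcoSigma
    (hThm2S : ∀ (L : ℕ), 1 < L → ∃ B₁ c₁ : ℝ, 0 < B₁ ∧ 0 < c₁ ∧ ∀ (F : T3Family), F.L = L → ∀ (n K : ℕ), n < K →
      ∃ (β₀ B₂ : ℝ) (len : LSite (F.P K).d → ℝ),
        Thm2SetupSUAt (F.P K) 2 (K - n) (eta F n K) β₀ B₁ B₂ c₁ len (fun _ => True))
    (hcoS : ∀ (L : ℕ), 1 < L → ∀ (B₁' : ℝ), 0 < B₁' → ∃ e₇ : ℝ, 0 < e₇ ∧
      ∀ (F : T3Family), F.L = L → ∀ (n K : ℕ) (hnK : n < K) (e : ℝ) (V : GaugeField (F.P n) 0 (Matrix.specialUnitaryGroup (Fin 2) ℂ))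
        (W : GaugeField (F.P K) 0 (Matrix.specialUnitaryGroup (Fin 2) ℂ)) (X : PBond (F.P K) 0 → Matrix (Fin 2) (Fin 2) ℂ),
        0 < e → e ≤ e₇ → W ∈ regFibrePr F n K hnK.le e V →
        (∀ γ : ℝ → GaugeField (F.P K) 0 (Matrix.specialUnitaryGroup (Fin 2) ℂ), γ 0 = W → (∀ t, γ t ∈ fibre F ℰp n K hnK.le V) →
          (∀ b, DifferentiableAt ℝ (fun t => ((γ t b : Matrix.specialUnitaryGroup (Fin 2) ℂ) : Matrix (Fin 2) (Fin 2) ℂ)) 0) →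
            deriv (fun t => wilsonAction4 (γ t)) 0 = 0) →
        In19 F n K (2 * B₁' * e) W (expHermField X) X → AvgCondPrint F n K hnK.le V W X → IsLandauPrint F n K W X →
          wilsonAction4 W ≤ wilsonAction4 (emb15 W (expHermField X))) :
    ∀ (L : ℕ), 1 < L → ∀ (B₁ : ℝ), 0 < B₁ → ∃ e₇ c₇ : ℝ, 0 < e₇ ∧ 0 < c₇ ∧
      ∀ (F : T3Family), F.L = L → ∀ (n K : ℕ) (hnK : n < K) (e α : ℝ) (V : GaugeField (F.P n) 0 (Matrix.specialUnitaryGroup (Fin 2) ℂ))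
        (W U₁ : GaugeField (F.P K) 0 (Matrix.specialUnitaryGroup (Fin 2) ℂ)) (u : GaugeTransf (F.P K) 0 (Matrix.specialUnitaryGroup (Fin 2) ℂ))
        (A : PBond (F.P K) 0 → Matrix (Fin 2) (Fin 2) ℂ),
        0 < e → e ≤ e₇ → 0 < α → α ≤ c₇ → W ∈ regFibrePr F n K hnK.le e V →
        (∀ γ : ℝ → GaugeField (F.P K) 0 (Matrix.specialUnitaryGroup (Fin 2) ℂ), γ 0 = W → (∀ t, γ t ∈ fibre F ℰp n K hnK.le V) →
          (∀ b, DifferentiableAt ℝ (fun t => ((γ t b : Matrix.specialUnitaryGroup (Fin 2) ℂ) : Matrix (Fin 2) (Fin 2) ℂ)) 0) →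
            deriv (fun t => wilsonAction4 (γ t)) 0 = 0) →
        RestrictedPrint F n K W u → (∀ b : PBond (F.P K) 0, IsSelfAdjoint (A b)) →
        (∀ b : PBond (F.P K) 0, ((U₁ b : Matrix.specialUnitaryGroup (Fin 2) ℂ) : Matrix (Fin 2) (Fin 2) ℂ) = exp (Complex.I • ((eta F n K) • A b))) →
        (∃ (β₀ B₂ : ℝ) (len : B7Prop1Explicit.Site (F.P K).d → ℝ),
          B8Thm2TorusAt.C136T (F.P K).L (K - n) (eta F n K) β₀ B₁ B₂ len α (pull (bgUnits F K W) (basePt F n K)) (pull A (basePt F n K))) →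
        B8Eq138LandauZd.IsLandau138 (F.P K).L (K - n) (eta F n K) (Set.univ : Set (B7Prop1Explicit.Site (F.P K).d)) (B8Thm4TorusAt.torusLam (K - n))
          (pull (bgUnits F K W) (basePt F n K)) (pull A (basePt F n K)) →
        B8Thm2TorusAt.C139T (F.P K).L (K - n) (eta F n K) B₁ α (pull (bgUnits F K W) (basePt F n K)) (pull A (basePt F n K)) →
        GaugeField.gaugeAct u (emb15 W U₁) ∈ regFibrePr F n K hnK.le e V →
          wilsonAction4 W ≤ wilsonAction4 (emb15 W U₁) := by
  intro L hL B₁ hB₁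
  obtain ⟨B₁T, c₁T, hB₁T, hc₁T, hT⟩ := hThm2S L hL
  obtain ⟨B₁', c₁', hB₁', hc₁', HS⟩ := exists_sigmaRep_of_thm2S (L := L) hB₁T hc₁T hT
  obtain ⟨e₇, he₇, Hco⟩ := hcoS L hL B₁' hB₁'
  have hC0 : 0 < C0 3 := C0_pos 3
  have hc2 : 0 < c2' 3 L := c2'_pos 3 L (by omega)
  -- windows of the Σ-representation: `2e ≤ c₁′`, `C₀·2e ≤ ⅓`, `4e ≤ c₂′`
  refine ⟨min e₇ (min (c₁' / 2) (min ((6 * C0 3)⁻¹) (c2' 3 L / 4))), 1, ?_, one_pos, ?_⟩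
  · exact lt_min he₇ (lt_min (by positivity) (lt_min (by positivity) (by positivity)))
  intro F hF n K hnK e α V W U₁ u A he heε _hα _hαc hWreg hEL _hRP _hA _hU₁ _h136 _h138 _h139 hmem
  have he₇' : e ≤ e₇ := heε.trans (min_le_left _ _)
  have h2e : 2 * e ≤ c₁' := by
    have := heε.trans ((min_le_right _ _).trans (min_le_left _ _)); linarith
  have hα3 : C0 3 * (2 * e) ≤ 1 / 3 := by
    have h1 : e ≤ (6 * C0 3)⁻¹ := heε.trans ((min_le_right _ _).trans ((min_le_right _ _).trans (min_le_left _ _)))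
    calc C0 3 * (2 * e) ≤ C0 3 * (2 * (6 * C0 3)⁻¹) := by gcongr
      _ = 1 / 3 := by field_simp; ring
  have hα2 : 2 * (2 * e) ≤ c2' 3 L := by
    have := heε.trans ((min_le_right _ _).trans ((min_le_right _ _).trans (min_le_right _ _))); linarith
  -- the Σ-representative of the competitor `(e^{iηA}W)^u`
  obtain ⟨u'', X'', hW', h19, h20, h21, hact⟩ :=
    HS F hF n K hnK e V W he h2e hα3 hα2 hWreg (GaugeField.gaugeAct u (emb15 W U₁)) hmem
  have hle : wilsonAction4 W ≤ wilsonAction4 (emb15 W (expHermField X'')) := Hco F hF n K hnK e V W X'' he he₇' hWreg hEL h19 h20 h21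
  have hga : wilsonAction4 (GaugeField.gaugeAct u (emb15 W U₁)) = wilsonAction4 (emb15 W U₁) :=
    T4WilsonGaugeFlatDirection.wilsonAction_gaugeAct 1 u _
  rw [← hga, hact]
  exact hle

end Summit.QuantumFields.YangMills.Theorems.Prop7HcoWOfHcoSigma

end
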